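import Mathlib
import HarnessLib
import Summits.ValiantsHypothesis.ValiantsHypothesis.Theses.MonotoneRestoration
import Literature.Computability.AlgebraicComplexity.ArithCircuit
import Literature.Computability.AlgebraicComplexity.ArithCircuitProofs
import Literature.Computability.AlgebraicComplexity.MonotoneStructure
import Literature.Computability.AlgebraicComplexity.PermanentIrreducible
import Literature.ModelTheory.FiniteModelTheory.CkEquiv
import Summits.ValiantsHypothesis.ValiantsHypothesis.Theorems.MonotoneRestorationMonotoneRestorationQPCosetCount
import Summits.ValiantsHypothesis.ValiantsHypothesis.Theorems.MonotoneRestorationMonotoneRestorationQPSymmetricLB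
import Summits.ValiantsHypothesis.ValiantsHypothesis.Theorems.MonotoneRestorationMonotoneRestorationQPSupportSymmetrisation
import Summits.ValiantsHypothesis.ValiantsHypothesis.Theorems.MonotoneRestorationMonotoneRestorationQPSparseRegime
import Summits.ValiantsHypothesis.ValiantsHypothesis.Theorems.MonotoneRestorationMonotoneRestorationQPBeta
import Literature.Computability.AlgebraicComplexity.SymmetricArithCircuit
import Literature.Computability.AlgebraicComplexity.DawarWilsenach2025Proofs
import Literature.GroupTheory.PermutationGroups.SmallIndexSubgroups
import Summits.ValiantsHypothesis.ValiantsHypothesis.Theorems.MonotoneRestorationQP.Negative.LoadBearing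
import Summits.ValiantsHypothesis.ValiantsHypothesis.Theorems.MonotoneRestorationMonotoneRestorationQPPermSupportCount

/-! TTRL-lite variant V18962 of stmt-ValiantsHypothesis-15886 -/

-- `ValiantsHypothesis.ValiantsHypothesis`: the D-0017 layout repeats the problem name in the path.
set_option linter.dupNamespace false

namespace Summit.ValiantsHypothesis.ValiantsHypothesis.Theorems

open Summit.ValiantsHypothesis.ValiantsHypothesis.Theses.MonotoneRestoration
open Literature.Computability.AlgebraicComplexity

/-- TTRL-lite variant V18962 (move `generalise`: coefficients in an arbitrary zerosumfree entire
commutative semiring `R`, i.e. `[NoZeroDivisors R] [Subsingleton (AddUnits R)]` — `ℝ≥0`, `ℕ`,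
`ℚ≥0`, …) of `stub_mulGate_children_extend`: in such a semiring nothing cancels, so for
`p * q ≠ 0` and any monomial `m'` of `q` (which exists since `q ≠ 0`), every monomial `m` of `p`
gives a monomial `m + m'` of `p * q` (the antidiagonal sum `coeff_mul` contains the nonzero term
`coeff m p * coeff m' q`, and a finite sum in `R` vanishes only if every term does,
`Finset.sum_eq_zero_iff`). Hence if the support of `p * q` translates into `f.support` by `μ`,
the support of `p` translates into `f.support` by `m' + μ`. [folklore] -/
theorem stub_mulGate_children_extend_var18962 :
    ∀ (R : Type) [CommSemiring R] [NoZeroDivisors R] [Subsingleton (AddUnits R)] (n : ℕ)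
      (p q f : MvPolynomial (Fin n × Fin n) R), p * q ≠ 0 →
      (∃ μ : (Fin n × Fin n) →₀ ℕ, ∀ m ∈ (p * q).support, m + μ ∈ f.support) →
      ∃ μ : (Fin n × Fin n) →₀ ℕ, ∀ m ∈ p.support, m + μ ∈ f.support := by
  classical
  intro R _ _ _ n p q f hpq hext
  obtain ⟨μ, hμ⟩ := hext
  have hq : q ≠ 0 := fun h => hpq (by rw [h, mul_zero])
  obtain ⟨m', hm'⟩ := MvPolynomial.support_nonempty.2 hq
  refine ⟨m' + μ, fun m hm => ?_⟩
  rw [← add_assoc]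
  refine hμ _ ?_
  rw [MvPolynomial.mem_support_iff] at hm hm' ⊢
  rw [MvPolynomial.coeff_mul]
  intro h
  have h0 := (Finset.sum_eq_zero_iff.1 h) (m, m') (Finset.HasAntidiagonal.mem_antidiagonal.2 rfl)
  rcases mul_eq_zero.1 h0 with h1 | h1
  · exact hm h1
  · exact hm' h1

end Summit.ValiantsHypothesis.ValiantsHypothesis.Theorems
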